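import Summits.QuantumAdvantage.QuantumAdvantage.Theorems.SosSandwichTransferPBAdvisedTree
import Summits.QuantumAdvantage.QuantumAdvantage.Theorems.SosSandwichTransferPBSimTreePB

/-!
# Crux `TransferPB` (stmt-QuantumAdvantage-15238, route SosSandwich), line `birth` — the GAPPED advisor is sound

Toward the machine half of stub `stub_pbOracleSimulation`. A machine with a PROMISE oracle learns the node
quantities of the simulation only through gapped tests — "`Var[p|_ρ] ≥ θ`?" (answer forced when `Var ≥ θ` or
`Var ≤ θ/2`), "`Inf_i[p|_ρ] ≥ w`?" (forced when `Inf_i ≥ w` or `Inf_i ≤ w/2`) — and an `η`-accurate estimate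
of `E[p|_ρ]`; between the thresholds the answers are ARBITRARY (and may depend on the path `ρ`). The natural
rule — stop if the variance test fails, else query the least variable whose influence test succeeds, else stop
— is the advisor `gapAdvisor`; this file proves it SOUND in the sense of
`Theorems/SosSandwichTransferPBAdvisedTree.lean` (`Advisor.Sound p θ (w/2) η`), granted COMPLETENESS: whenever
`Var[p|_ρ] > θ/2` some variable has influence `≥ w` — which PB-AA supplies along every path of a
pseudo-bounded `p` (`pseudoBounded_restrictPath`, `complete_of_pb`). With `advTree_error_le` this settles the
analysis of the machine's walk; what remains is the string encoding of the tests as ONE promise problem in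
`PromiseBQP` and the transcript machine itself.

* `GapAnswers` (data: the three answer tables), `GapAnswers.Faithful` (the forcing conditions w.r.t. `p`);
* `gapAdvisor`, **`gapAdvisor_sound`**;
* `pseudoBounded_restrictPath`, **`complete_of_pb`** (completeness from the PB-AA influence bound at order `d`).

All proved; abstract (no machines, no oracle encoding). Source: S. Aaronson, A. Ambainis, Theory Comput. 10
(2014), proof of Thm. 23 (p. 14: the node quantities need only be decided with gaps / estimated).
-/

-- D-0017: single-conjunct summit ⇒ the duplicate `QuantumAdvantage.QuantumAdvantage` is mandated.
set_option linter.dupNamespace false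

noncomputable section

namespace Summit.QuantumAdvantage.QuantumAdvantage.Cruxes.TransferPB.Birth

open Finset Literature.Computability.QuantumComplexity Literature.Computability.QuantumComplexity.ClassicalSimulation

namespace SimTreePB

variable {N : ℕ}

/-- **Gapped answers**: path-indexed answer tables to the variance test, the influence tests, and the mean
estimate (what a machine reads off a promise oracle along its walk). [cite: AaronsonAmbainis2014, Thm. 23 (proof, p. 14)] -/
structure GapAnswers (N : ℕ) where
  /-- answer to "`Var[p|_ρ] ≥ θ`?" -/
  varBig : List (Fin N × Bool) → Bool
  /-- answer to "`Inf_i[p|_ρ] ≥ w`?" -/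
  infBig : List (Fin N × Bool) → Fin N → Bool
  /-- estimate of `E[p|_ρ]` -/
  est : List (Fin N × Bool) → ℝ

/-- **Faithfulness of gapped answers** for `p` with thresholds `(θ, w)` and precision `η`: the variance answer
is forced to `true` when `Var ≥ θ` and to `false` when `Var ≤ θ/2`; the influence answer for `i` is forced to
`true` when `Inf_i ≥ w` and to `false` when `Inf_i ≤ w/2`; the estimate is `η`-close to the mean. (Exactly what
a promise oracle correct on the promise guarantees; nothing is demanded inside the gaps.) -/
def GapAnswers.Faithful (O : GapAnswers N) (p : MvPolynomial (Fin N) ℝ) (θ w η : ℝ) : Prop :=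
  (∀ ρ : List (Fin N × Bool),
      (θ ≤ boolVariance (restrictPath ρ p) → O.varBig ρ = true) ∧
      (boolVariance (restrictPath ρ p) ≤ θ / 2 → O.varBig ρ = false)) ∧
  (∀ (ρ : List (Fin N × Bool)) (i : Fin N),
      (w ≤ influence i (restrictPath ρ p) → O.infBig ρ i = true) ∧
      (influence i (restrictPath ρ p) ≤ w / 2 → O.infBig ρ i = false)) ∧
  (∀ ρ : List (Fin N × Bool), |O.est ρ - boolAvg (evalBool (restrictPath ρ p))| ≤ η)

open scoped Classical in
/-- **The gapped advisor**: stop if the variance test fails; otherwise query the LEAST variable whose influence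
test succeeds (a definite rule a machine implements by scanning `i = 0, 1, …`); stop if none does. Leaf value =
the estimate. [cite: AaronsonAmbainis2014, Thm. 21 (proof) and Thm. 23 (proof, p. 14)] -/
def gapAdvisor (O : GapAnswers N) : Advisor N where
  pick ρ := if O.varBig ρ = true then
      (if h : ∃ i, O.infBig ρ i = true then some (Fin.find (fun i => O.infBig ρ i = true) h) else none)
    else none
  val := O.est

/-- The picked variable passed its influence test. [folklore] -/
theorem infBig_of_gapAdvisor_pick {O : GapAnswers N} {ρ : List (Fin N × Bool)} {i : Fin N}
    (h : (gapAdvisor O).pick ρ = some i) : O.varBig ρ = true ∧ O.infBig ρ i = true := by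
  classical
  unfold gapAdvisor at h
  dsimp only at h
  split_ifs at h with hv h'
  injection h with h
  subst h
  exact ⟨hv, Fin.find_spec (p := fun i => O.infBig ρ i = true) h'⟩

/-- A refusal means: the variance test failed, or every influence test failed. [folklore] -/
theorem gapAdvisor_pick_eq_none {O : GapAnswers N} {ρ : List (Fin N × Bool)}
    (h : (gapAdvisor O).pick ρ = none) : O.varBig ρ = false ∨ ∀ i, O.infBig ρ i = false := by
  classical
  unfold gapAdvisor at h
  dsimp only at h
  split_ifs at h with hv h'
  · right
    intro i
    by_contra hi
    exact h' ⟨i, by simpa using hi⟩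
  · left
    simpa using hv

/-- **The gapped advisor is sound** with parameters `(θ, w/2, η)`, granted faithful answers and COMPLETENESS
(`Var[p|_ρ] > θ/2 ⇒` some variable has influence `≥ w`): a picked variable passed its influence test, so its
influence is `> w/2`; a refusal comes from a failed variance test (`Var < θ`) or from all influence tests failing
(no influence `≥ w`, hence `Var ≤ θ/2` by completeness). [cite: AaronsonAmbainis2014, Thm. 23 (proof, p. 14)] -/
theorem gapAdvisor_sound {O : GapAnswers N} {p : MvPolynomial (Fin N) ℝ} {θ w η : ℝ} (hθ : 0 ≤ θ)
    (hO : O.Faithful p θ w η)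
    (hcomplete : ∀ ρ : List (Fin N × Bool), θ / 2 < boolVariance (restrictPath ρ p) →
      ∃ i : Fin N, w ≤ influence i (restrictPath ρ p)) :
    (gapAdvisor O).Sound p θ (w / 2) η := by
  obtain ⟨hvar, hinf, hest⟩ := hO
  refine ⟨fun ρ i hpick => ?_, fun ρ hnone => ?_, fun ρ => hest ρ⟩
  · obtain ⟨-, hi⟩ := infBig_of_gapAdvisor_pick hpick
    by_contra hlt
    have hsmall : influence i (restrictPath ρ p) ≤ w / 2 := (not_le.1 hlt).le
    have := (hinf ρ i).2 hsmall
    rw [this] at hi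
    exact Bool.false_ne_true hi
  · rcases gapAdvisor_pick_eq_none hnone with hv | hall
    · by_contra hbig
      have := (hvar ρ).1 (not_le.1 hbig).le
      rw [hv] at this
      exact Bool.false_ne_true this
    · by_contra hbig
      have hbig' : θ / 2 < boolVariance (restrictPath ρ p) := by
        have : θ / 2 ≤ θ := by linarith
        exact lt_of_le_of_lt this (not_le.1 hbig)
      obtain ⟨i, hi⟩ := hcomplete ρ hbig'
      have := (hinf ρ i).1 hi
      rw [hall i] at this
      exact Bool.false_ne_true this

/-! ### Completeness from PB-AA -/

/-- `K_T` is closed under restriction along a path. [cite: KaniewskiLeeDewolf2015, Thm. 12] -/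
theorem pseudoBounded_restrictPath {T : ℕ} : ∀ (ρ : List (Fin N × Bool)) {p : MvPolynomial (Fin N) ℝ},
    PseudoBounded T p → PseudoBounded T (restrictPath ρ p)
  | [], _, h => h
  | e :: ρ, _, h => pseudoBounded_restrictPath ρ (pseudoBounded_restrictPoly h e.1 e.2)

/-- **Completeness from the PB-AA influence bound.** If every `q ∈ K_d` (in `N` variables) with
`Var[q] ≥ ε' > 0` has a variable of influence `≥ C (ε'/d)^c`, then along every path of a `p ∈ K_T`, `T ≤ d`:
`Var[p|_ρ] > θ/2 ⇒ ∃ i, Inf_i[p|_ρ] ≥ C ((θ/2)/d)^c` (for `θ > 0`). [cite: AaronsonAmbainis2014, Thm. 23 (proof, p. 14)] -/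
theorem complete_of_pb {c : ℕ} {C : ℝ} {d T : ℕ} (hTd : T ≤ d)
    (H : ∀ (q : MvPolynomial (Fin N) ℝ) (ε : ℝ), PseudoBounded d q → 0 < ε → ε ≤ boolVariance q →
        ∃ i : Fin N, C * (ε / d) ^ c ≤ influence i q)
    {p : MvPolynomial (Fin N) ℝ} (hp : PseudoBounded T p) {θ : ℝ} (hθ : 0 < θ) :
    ∀ ρ : List (Fin N × Bool), θ / 2 < boolVariance (restrictPath ρ p) →
      ∃ i : Fin N, C * ((θ / 2) / d) ^ c ≤ influence i (restrictPath ρ p) :=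
  fun ρ hv => H _ (θ / 2) (pseudoBounded_restrictPath ρ (hp.mono hTd)) (by positivity) hv.le

end SimTreePB

end Summit.QuantumAdvantage.QuantumAdvantage.Cruxes.TransferPB.Birth

end
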